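import Literature.Analysis.FluidPDE.Tao2016AveragedNS.SplitCascadeZeroScaleDrainFinal
import Literature.Analysis.FluidPDE.Tao2016AveragedNS.SplitCascadeReducedClaimLinks
import HarnessLib

/-!
# The split Prop. 6.5: Prop. 6.15♯ pointwise — the next state from the hypotheses, the bootstrap regime and the window

T. Tao, *Finite time blowup for an averaged three-dimensional Navier–Stokes equation*,
arXiv:1402.0290v3, §6.6 Prop. 6.15, §6.7.
HONEST FRAMING: statements about the SPLIT cascade model system; nothing here proves the split
Prop. 6.5 and nothing here concerns the true Navier–Stokes equations.

The pointwise form of Prop. 6.15 for the split system (the input `h615` of the tree's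
`reducedClaimIIInput_of_setting`): from the split hypotheses with error constant `C₁/2`, the regime
inequalities of `ZeroScale.Regime` (with `C₄ = 11`, `C₅ = C₂(1+ε₀)²(cumEnergyConst ε₀ C₃ + 100) + C₁`),
`K ≥ 10¹⁸`, `GoodAt` on `[0, T]`, the Prop. 6.13 bounds `SmallModes K ε 11`, the pointwise window
certificate with its strong master smallness, and the exit trichotomy at `T`: there is
`τ₁ ∈ [1/100, T]` with `NextState ε₀ K ε Y F τ₁` ((6.139)–(6.144)). Composition of
`zeroScale_context_and_window` (`SplitCascadeReducedClaimLinks.lean`), the `Setting` packaging and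
`Setting.exists_nextState` (`SplitCascadeZeroScaleDrainFinal.lean`).

## References

* T. Tao, arXiv:1402.0290v3, §6.6 Prop. 6.15, §6.7. [`Tao2016AveragedNS`]
-/

noncomputable section

open Set MeasureTheory intervalIntegral

namespace Literature.Analysis.FluidPDE

namespace Tao2016AveragedNS

open TaoCascade hiding ExitTrichotomy
open TaoCascade.ZeroScale hiding Context Setting

section NextStateOfWindow

variable {ε₀ K ε C₁ C₂ C₃ : ℝ} {n₀ N : ℤ} {ηp : ℤ → ℝ} {βp : ℕ → ℝ} {τ : ℤ → ℝ}
  {Y : Fin 4 → ℤ → ℝ → ℝ} {W : Fin 3 → ℤ → ℝ → ℝ} {F : ℤ → ℝ → ℝ}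

/-- **Prop. 6.15♯, pointwise.** [cite: Tao2016AveragedNS, §6.6 Prop. 6.15; §6.7 Props. 6.16–6.17] -/
theorem RescaledSplitHypotheses.nextState_of_window
    (h : RescaledSplitHypotheses (1 / 10 ^ 5 * Real.exp (-K ^ 10 / 2)) ε₀ K ε (C₁ / 2) C₂ C₃ n₀ N
      ηp βp τ Y W F)
    (hε₀ : 0 < ε₀) (hε₀1 : ε₀ < 1) (hε : 0 < ε) (hε1 : ε ≤ 1) (hC₁ : 0 ≤ C₁) (hC₂ : 0 ≤ C₂)
    (hC₃ : 0 ≤ C₃) (hN : n₀ ≤ N)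
    (hK18 : (10 : ℝ) ^ 18 ≤ K) (hKε₀ : (10 : ℝ) ^ 6 ≤ K * ε₀)
    (hεexp : ε * Real.exp (10 ^ 6 * K ^ 10) ≤ 1)
    (hlate : (C₁ + C₂ + (C₂ * (1 + ε₀) ^ (2 : ℝ) * (cumEnergyConst ε₀ C₃ + 100) + C₁) + 1) *
      (1 + ε₀) ^ (-(n₀ : ℝ) / 4) ≤ ε ^ 4 * Real.exp (-10 * K ^ 10))
    {T : ℝ} (hT : T ∈ Icc (0 : ℝ) 100) (hgood : ∀ t ∈ Icc 0 T, GoodAt ε₀ K Y F t)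
    (hsmall : SmallModes K ε 11 Y T) {ζ : ℝ}
    (hasym : ∀ t ∈ Icc 0 T, ∀ i : Fin 3, |W i (-1) t| ≤ ζ ∧ |W i 0 t| ≤ ζ ∧ |W i 1 t| ≤ ζ)
    (hs : 16 * (K ^ 5 * (1 + ε₀) ^ (2 : ℝ)) * ((ε ^ 2)⁻¹ + ε⁻¹ * K ^ 10 + K + 1) * ζ ^ 2 ≤
      C₁ / 2 * (1 + ε₀) ^ (-(n₀ : ℝ) / 2))
    (hex : ZeroScale.ExitTrichotomy ε₀ K Y F T) :
    ∃ τ₁ ∈ Icc (1 / 100 : ℝ) T, NextState ε₀ K ε Y F τ₁ := by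
  have hK6 : (10 : ℝ) ^ 6 ≤ K := le_trans (by norm_num) hK18
  have hK2 : 2 ≤ K := le_trans (by norm_num) hK6
  have hK11 : (11 : ℝ) ≤ K := le_trans (by norm_num) hK6
  obtain ⟨hctx, hw⟩ := h.zeroScale_context_and_window hε₀ hε₀1 hK2 hε hε1 hC₁ hC₂ hC₃ hN hT hgood
    (by norm_num : (0 : ℝ) ≤ 11) hsmall hasym hs
  have hset : ZeroScale.Setting ε₀ K ε C₁ C₂ C₃ 11
      (C₂ * (1 + ε₀) ^ (2 : ℝ) * (cumEnergyConst ε₀ C₃ + 100) + C₁) n₀ N ηp βp τ Y W F T ζ :=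
    { toContext := hctx
      K_large := hK6
      Kε₀ := hKε₀
      C₄_le := hK11
      ε_exp := hεexp
      late := hlate }
  exact hset.exists_nextState hw hK18 hex

end NextStateOfWindow

end Tao2016AveragedNS

end Literature.Analysis.FluidPDE
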